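import Literature.Computability.Cryptography.LiuPassLemma53Defs
import Literature.Computability.Cryptography.LiuPassCondGenProgram
import Literature.Computability.Cryptography.AffineHashProgram
import HarnessLib

/-!
# Liu–Pass Lemma 5.3: the family `f'_i` and the hard-core function `GL` are polynomial time

Efficiency level of the decomposition of `condEPPRG_of_OWFExist` (Liu–Pass, FOCS 2020, Thm 5.5):
the two "efficiently computable" claims of Lemma 5.3 for the construction `L53Params` of
`LiuPassLemma53Defs.lean`, as pipelines of the tree's `FP` bricks (no new machine):

* the unary arithmetic of the construction's lengths (`totU`, `kkU`, `mU`, `LU`, `MU`, `R1U`,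
  `R2U`: `1ⁿ ↦ 1^{3n^c}, 1^{γ'⌊log₂ n⌋}, 1^{m(n)}, 1^{L(n)}, 1^{M(n)}, 1^{n(n+1)}, 1^{n(M+1)}`);
* a generic clocked search `Srch.findU` for `max {n : len n ≤ |u|}` (the pattern of `CondGen.nOfU`,
  now parameterised by the unary length brick) and the block length `nOf |w|` (`nOfU`);
* the Goldreich–Levin bits `GL_k(x, σ)` by a clocked loop of inner products (`glFn`,
  `glFn_boolPair`; one `andParityFn` per block);
* `HcF = L53Params.Hc` (`HcF_apply`, `HcF_mem_FP`), whence `L53Params.Hc_mem_FP`;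
* `FF = ⟨1ⁱ, w⟩ ↦ f'_i(w)` (`FF_apply`: parsing, the two affine hashes `AffineProg.hashFn`, the
  padding `CondGen.fitF`, one call of `f`), whence `L53Params.F_mem_FP` (for `f ∈ FP`).

## References

* Y. Liu, R. Pass, *On one-way functions and Kolmogorov complexity*, FOCS 2020
  (arXiv:2009.11514), Lemma 5.3 ("efficiently computable `{f'_i}`, `GL`") and Appendix.
* S. Arora, B. Barak, *Computational Complexity: A Modern Approach*, CUP 2009, §1.3, §1.4.1.
-/

namespace Literature.Computability.Cryptography

open _root_.Computability Polynomial Complexity Complexity.Brick Complexity.Plumb Complexity.OracleCompose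
  Complexity.HashBricks CondRed AffineStr

/-- `ipBit` is the parity of the bitwise `AND` (the format of `andParityFn`). [folklore] -/
theorem ipBit_eq_decide_odd : ∀ x σ : List Bool, ipBit x σ = decide (Odd ((x.zipWith (· && ·) σ).count true))
  | [], σ => by simp
  | b :: x, [] => by simp
  | b :: x, c :: σ => by
    rw [ipBit_cons_cons, ipBit_eq_decide_odd x σ, List.zipWith_cons_cons, List.count_cons]
    cases b <;> cases c <;> simp [Nat.odd_add_one, -Nat.not_odd_iff_even]

namespace L53Prog

variable (Q : L53Params)

/-! ### The lengths of the construction in unary (on a word of length `n`) -/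

/-- `1^{3n^c}`. [folklore] -/
noncomputable def totU : List Bool → List Bool := polyFn (C 3 * X ^ Q.c)
/-- `1^{n + 3n^c}` (the seed length). [folklore] -/
noncomputable def lenU : List Bool → List Bool := concatFn ∘ fanoutFn onesFn (totU Q)
/-- `1^{γ'⌊log₂ n⌋}`. [folklore] -/
noncomputable def kkU : List Bool → List Bool := umulFn ∘ fanoutFn (fun _ => ones Q.γ') logU
/-- `1^{m(n)}`, `m = 3n^c − γ'⌊log₂ n⌋·n`. [folklore] -/
noncomputable def mU : List Bool → List Bool := dropFn ∘ fanoutFn (umulFn ∘ fanoutFn (kkU Q) onesFn) (totU Q)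
/-- `1^{s(n)}`, `s(n) = n − ⌊log₂ n⌋ − 1` (`lpS53`). [folklore] -/
noncomputable def s53U : List Bool → List Bool := dropFn ∘ fanoutFn (List.cons true ∘ logU) onesFn
/-- `1^{L(n)}`, `L = s(n) − 2α'⌊log₂ n⌋`. [folklore] -/
noncomputable def LU : List Bool → List Bool :=
  dropFn ∘ fanoutFn (umulFn ∘ fanoutFn (fun _ => ones (2 * Q.α')) logU) (s53U)
/-- `1^{M(n)}`, `M = P(n) + 1`. [folklore] -/
noncomputable def MU : List Bool → List Bool := polyFn (Q.P + 1)
/-- `1^{n(n+1)}` (`R₁`). [folklore] -/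
noncomputable def R1U : List Bool → List Bool := polyFn (X * (X + 1))
/-- `1^{n(M(n)+1)}` (`R₂`). [folklore] -/
noncomputable def R2U : List Bool → List Bool := polyFn (X * (Q.P + C 2))

variable {Q}

/-- Value of `totU`. [folklore] -/
@[simp] theorem totU_apply (w : List Bool) : totU Q w = ones (Q.tot w.length) := by
  simp [totU, L53Params.tot]

/-- Value of `lenU`. [folklore] -/
@[simp] theorem lenU_apply (w : List Bool) : lenU Q w = ones (w.length + Q.tot w.length) := by
  simp only [lenU, Function.comp_apply, fanoutFn_apply, concatFn_boolPair, onesFn_eq_ones, totU_apply, Com.ones_append]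

/-- Value of `kkU`. [folklore] -/
@[simp] theorem kkU_apply (w : List Bool) : kkU Q w = ones (Q.kk w.length) := by
  simp only [kkU, Function.comp_apply, fanoutFn_apply, logU_apply, umulFn_boolPair, L53Params.kk]

/-- Value of `mU`. [folklore] -/
@[simp] theorem mU_apply (w : List Bool) : mU Q w = ones (Q.m w.length) := by
  simp only [mU, Function.comp_apply, fanoutFn_apply, kkU_apply, onesFn_eq_ones, umulFn_boolPair, totU_apply,
    dropFn_boolPair, List.length_replicate, ones, List.drop_replicate, L53Params.m]

/-- Value of `s53U`. [folklore] -/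
@[simp] theorem s53U_apply (w : List Bool) : s53U w = ones (lpS53 w.length) := by
  simp only [s53U, Function.comp_apply, fanoutFn_apply, logU_apply, true_cons_ones, onesFn_eq_ones, dropFn_boolPair,
    List.length_replicate, ones, List.drop_replicate, lpS53, Nat.sub_sub, Nat.add_comm]

/-- Value of `LU`. [folklore] -/
@[simp] theorem LU_apply (w : List Bool) : LU Q w = ones (Q.L w.length) := by
  simp only [LU, Function.comp_apply, fanoutFn_apply, logU_apply, umulFn_boolPair, s53U_apply, dropFn_boolPair,
    List.length_replicate, ones, List.drop_replicate, L53Params.L]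

/-- Value of `MU`. [folklore] -/
@[simp] theorem MU_apply (w : List Bool) : MU Q w = ones (Q.M w.length) := by
  simp [MU, L53Params.M]

/-- Value of `R1U`. [folklore] -/
@[simp] theorem R1U_apply (w : List Bool) : R1U w = ones (L53Params.R₁ w.length) := by
  simp [R1U, L53Params.R₁]

/-- Value of `R2U`. [folklore] -/
@[simp] theorem R2U_apply (w : List Bool) : R2U Q w = ones (Q.R₂ w.length) := by
  simp [R2U, L53Params.R₂, L53Params.M]

/-- `totU ∈ FP`. [folklore] -/
theorem totU_mem_FP : totU Q ∈ FP := polyFn_mem_FP _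
/-- `lenU ∈ FP`. [folklore] -/
theorem lenU_mem_FP : lenU Q ∈ FP := comp_mem_FP concatFn_mem_FP (fanoutFn_mem_FP onesFn_mem_FP totU_mem_FP)
/-- `kkU ∈ FP`. [folklore] -/
theorem kkU_mem_FP : kkU Q ∈ FP := comp_mem_FP umulFn_mem_FP (fanoutFn_mem_FP (const_mem_FP _) logU_mem_FP)
/-- `mU ∈ FP`. [folklore] -/
theorem mU_mem_FP : mU Q ∈ FP :=
  comp_mem_FP dropFn_mem_FP (fanoutFn_mem_FP (comp_mem_FP umulFn_mem_FP (fanoutFn_mem_FP kkU_mem_FP onesFn_mem_FP)) totU_mem_FP)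
/-- `s53U ∈ FP`. [folklore] -/
theorem s53U_mem_FP : s53U ∈ FP :=
  comp_mem_FP dropFn_mem_FP (fanoutFn_mem_FP (comp_mem_FP (cons_mem_FP true) logU_mem_FP) onesFn_mem_FP)
/-- `LU ∈ FP`. [folklore] -/
theorem LU_mem_FP : LU Q ∈ FP :=
  comp_mem_FP dropFn_mem_FP (fanoutFn_mem_FP (comp_mem_FP umulFn_mem_FP (fanoutFn_mem_FP (const_mem_FP _) logU_mem_FP)) s53U_mem_FP)
/-- `MU ∈ FP`. [folklore] -/
theorem MU_mem_FP : MU Q ∈ FP := polyFn_mem_FP _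
/-- `R1U ∈ FP`. [folklore] -/
theorem R1U_mem_FP : R1U ∈ FP := polyFn_mem_FP _
/-- `R2U ∈ FP`. [folklore] -/
theorem R2U_mem_FP : R2U Q ∈ FP := polyFn_mem_FP _

/-! ### A generic clocked search for `max {n : len n ≤ |u|}` -/

end L53Prog

namespace Srch

variable (lenU : List Bool → List Bool) (len : ℕ → ℕ)

/-- The search condition `[len (k+1) ≤ |u|]` on the state `⟨u, 1ᵏ⟩`, for a unary length brick
`lenU : 1ᵏ ↦ 1^{len k}`. [folklore] -/
noncomputable def srchCond : List Bool → List Bool :=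
  lenLeFn X ∘ fanoutFn fstF (lenU ∘ List.cons true ∘ sndF)

/-- One round of the search: `k ↦ k + 1` while `len (k+1) ≤ |u|`. [folklore] -/
noncomputable def srchRound : List Bool → List Bool :=
  fanoutFn fstF (iteFn (srchCond lenU) (List.cons true ∘ sndF) sndF)

/-- The model of the search: `i` rounds from `k = 0` at word length `N`. [folklore] -/
def srchN (N : ℕ) : ℕ → ℕ
  | 0 => 0
  | i + 1 => if len (srchN N i + 1) ≤ N then srchN N i + 1 else srchN N i

/-- **`findU u = 1^{max {n ≤ |u| : len n ≤ |u|}}`**: `|u|` rounds of the search from `⟨u, ε⟩`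
(`findU_apply`). The generic form of `CondGen.nOfU` (`LiuPassCondGenProgram.lean`, the instance
`len = CondParams.seedLen`, kept there as is). [Arora–Barak 2009, §1.4.1 (clocked loops)] [folklore] -/
noncomputable def findU : List Bool → List Bool :=
  sndF ∘ (fun S => (srchRound lenU)^[(X : Polynomial ℕ).eval (boolUnpair S).1.length] S) ∘ fanoutFn id (fun _ => [])

variable {lenU len}

/-- Value of the search condition on a state. [folklore] -/
theorem srchCond_state (hlen : ∀ k, lenU (ones k) = ones (len k)) (u : List Bool) (k : ℕ) :
    srchCond lenU (boolPair u (ones k)) = [decide (len (k + 1) ≤ u.length)] := by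
  simp only [srchCond, Function.comp_apply, fanoutFn_apply, fstF_boolPair, sndF_boolPair, true_cons_ones, hlen,
    List.length_replicate, lenLeFn_boolPair, eval_X]

/-- Value of the search round on a state. [folklore] -/
theorem srchRound_state (hlen : ∀ k, lenU (ones k) = ones (len k)) (u : List Bool) (k : ℕ) :
    srchRound lenU (boolPair u (ones k)) = boolPair u (ones (if len (k + 1) ≤ u.length then k + 1 else k)) := by
  unfold srchRound
  rw [fanoutFn_apply, fstF_boolPair]
  congr 1
  by_cases h : len (k + 1) ≤ u.length
  · rw [iteFn_apply_true (by rw [srchCond_state hlen, decide_eq_true h]), if_pos h]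
    simp [true_cons_ones]
  · rw [iteFn_apply_false (by rw [srchCond_state hlen, decide_eq_false h]), if_neg h]
    simp

/-- Additive growth of the search round, on every word. [folklore] -/
theorem length_srchRound_le (lenU : List Bool → List Bool) (S : List Bool) : (srchRound lenU S).length ≤ S.length + 3 := by
  have h1 := length_fstF_sndF_le S
  unfold srchRound
  rcases lenLeFn_eq_or X (fanoutFn fstF (lenU ∘ List.cons true ∘ sndF) S) with h | h
  · rw [fanoutFn_apply, iteFn_apply_true (by simpa [srchCond] using h)]
    simp only [length_boolPair, Function.comp_apply, List.length_cons]
    omega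
  · rw [fanoutFn_apply, iteFn_apply_false (by simpa [srchCond] using h)]
    simp only [length_boolPair]
    omega

/-- The rounds follow the model. [folklore] -/
theorem iterate_srchRound (hlen : ∀ k, lenU (ones k) = ones (len k)) (u : List Bool) : ∀ i : ℕ,
    (srchRound lenU)^[i] (boolPair u []) = boolPair u (ones (srchN len u.length i))
  | 0 => rfl
  | i + 1 => by
    rw [Function.iterate_succ_apply', iterate_srchRound hlen u i, srchRound_state hlen]
    rfl

/-- The model stays admissible and stops only when the next length does not fit. [folklore] -/
theorem srchN_spec {N : ℕ} (h0 : len 0 ≤ N) : ∀ i : ℕ,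
    len (srchN len N i) ≤ N ∧ (srchN len N i = i ∨ N < len (srchN len N i + 1))
  | 0 => ⟨h0, Or.inl rfl⟩
  | i + 1 => by
    obtain ⟨h1, h2⟩ := srchN_spec h0 i
    simp only [srchN]
    split_ifs with h
    · refine ⟨h, Or.inl ?_⟩
      rcases h2 with h2 | h2
      · rw [h2]
      · exact absurd h (not_le.2 h2)
    · exact ⟨h1, Or.inr (not_le.1 h)⟩

/-- **`findGreatest` by sandwiching** for a strictly increasing `len` with `n ≤ len n`:
`len k ≤ ℓ < len (k+1)` gives `max {n ≤ ℓ : len n ≤ ℓ} = k`. [folklore] -/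
theorem findGreatest_eq_of (hmono : StrictMono len) (hle : ∀ n, n ≤ len n) {k ℓ : ℕ} (h1 : len k ≤ ℓ) (h2 : ℓ < len (k + 1)) :
    Nat.findGreatest (fun n => len n ≤ ℓ) ℓ = k := by
  set g := Nat.findGreatest (fun n => len n ≤ ℓ) ℓ with hg
  apply le_antisymm
  · have hP : len g ≤ ℓ := by
      by_cases hz : g = 0
      · rw [hz]; exact le_trans (hmono.monotone (Nat.zero_le k)) h1
      · exact Nat.findGreatest_of_ne_zero (P := fun n => len n ≤ ℓ) hg.symm hz
    by_contra hlt
    push Not at hlt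
    have hm : len (k + 1) ≤ len g := hmono.monotone (Nat.succ_le_of_lt hlt)
    omega
  · exact Nat.le_findGreatest ((hle k).trans h1) h1

/-- **After `N` rounds the model is `max {n ≤ N : len n ≤ N}`.** [folklore] -/
theorem srchN_self (hmono : StrictMono len) (hle : ∀ n, n ≤ len n) (h0 : len 0 = 0) (N : ℕ) :
    srchN len N N = Nat.findGreatest (fun n => len n ≤ N) N := by
  obtain ⟨h1, h2⟩ := srchN_spec (len := len) (N := N) (by rw [h0]; exact Nat.zero_le _) N
  have h2' : N < len (srchN len N N + 1) := by
    rcases h2 with h2 | h2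
    · rw [h2]; exact Nat.lt_of_lt_of_le (Nat.lt_succ_self N) (hle _)
    · exact h2
  exact (findGreatest_eq_of hmono hle h1 h2').symm

/-- **`findU u = 1^{max {n ≤ |u| : len n ≤ |u|}}`.** [folklore] -/
theorem findU_apply (hlen : ∀ k, lenU (ones k) = ones (len k)) (hmono : StrictMono len) (hle : ∀ n, n ≤ len n)
    (h0 : len 0 = 0) (u : List Bool) : findU lenU u = ones (Nat.findGreatest (fun n => len n ≤ u.length) u.length) := by
  have h := iterate_srchRound hlen u u.length
  simp only [findU, Function.comp_apply, fanoutFn_apply, id, boolUnpair_boolPair, eval_X]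
  rw [h, sndF_boolPair, srchN_self hmono hle h0]

/-- `srchRound lenU ∈ FP` for `lenU ∈ FP`. [folklore] -/
theorem srchRound_mem_FP (hl : lenU ∈ FP) : srchRound lenU ∈ FP :=
  fanoutFn_mem_FP fstF_mem_FP (iteFn_mem_FP
    (comp_mem_FP (lenLeFn_mem_FP X) (fanoutFn_mem_FP fstF_mem_FP
      (comp_mem_FP hl (comp_mem_FP (cons_mem_FP true) sndF_mem_FP))))
    (comp_mem_FP (cons_mem_FP true) sndF_mem_FP) sndF_mem_FP)

/-- **`findU lenU ∈ FP`** for `lenU ∈ FP` (a clocked loop of additive growth). [Arora–Barak 2009,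
§1.4.1] [folklore] -/
theorem findU_mem_FP (hl : lenU ∈ FP) : findU lenU ∈ FP :=
  comp_mem_FP sndF_mem_FP (comp_mem_FP (iterate_mem_FP (srchRound_mem_FP hl) 3 (length_srchRound_le lenU) X)
    (fanoutFn_mem_FP OracleCompose.id_mem_FP (const_mem_FP _)))

end Srch

namespace L53Prog

variable (Q)

/-! ### The block length `nOf |u|` -/

/-- **`nOfU u = 1^{nOf |u|}`**: the generic search for `len n = n + 3n^c`. [folklore] -/
noncomputable def nOfU : List Bool → List Bool := Srch.findU (lenU Q)

variable {Q}

/-- **`nOfU u = 1^{nOf |u|}`.** [folklore] -/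
@[simp] theorem nOfU_apply (u : List Bool) : nOfU Q u = ones (Q.nOf u.length) := by
  have h0 : 0 + Q.tot 0 = 0 := by
    simp [L53Params.tot, zero_pow (by have := Q.one_le_c; omega : Q.c ≠ 0)]
  have h := Srch.findU_apply (lenU := lenU Q) (len := fun n => n + Q.tot n)
    (fun k => by rw [lenU_apply, List.length_replicate]) Q.strictMono_add_tot (fun n => Nat.le_add_right _ _) h0 u
  rw [nOfU, h]
  rfl

/-- `nOfU ∈ FP`. [folklore] -/
theorem nOfU_mem_FP : nOfU Q ∈ FP := Srch.findU_mem_FP lenU_mem_FP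

/-! ### The Goldreich–Levin bits by a clocked loop -/

/-- The loop state `⟨1ᵏ, ⟨1ⁿ, ⟨x, ⟨σ, ⟨1ʲ, acc⟩⟩⟩⟩⟩`. [folklore] -/
def gState (k n : ℕ) (x σ : List Bool) (j : ℕ) (acc : List Bool) : List Bool :=
  boolPair (ones k) (boolPair (ones n) (boolPair x (boolPair σ (boolPair (ones j) acc))))

/-- The block offset `1^{j n}`. [folklore] -/
noncomputable def blkStartU : List Bool → List Bool := umulFn ∘ fanoutFn (nthF 4) (nthF 1)
/-- Block `j` of `σ`: `(σ ⇂ jn) ↾ n`. [folklore] -/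
noncomputable def blkF : List Bool → List Bool := takeFn ∘ fanoutFn (nthF 1) (dropFn ∘ fanoutFn blkStartU (nthF 3))
/-- The inner-product bit `[⟨x, σ_j⟩]`. [folklore] -/
noncomputable def gbitF : List Bool → List Bool := andParityFn ∘ fanoutFn (nthF 2) blkF
/-- **One round**: append bit `j`, advance `j`. [folklore] -/
noncomputable def gRoundF : List Bool → List Bool :=
  fanoutFn fstF (fanoutFn (nthF 1) (fanoutFn (nthF 2) (fanoutFn (nthF 3)
    (fanoutFn (List.cons true ∘ nthF 4) (concatFn ∘ fanoutFn (sndPow 4) gbitF)))))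
/-- The initial state from the input `⟨⟨1ᵏ, 1ⁿ⟩, ⟨x, σ⟩⟩`. [folklore] -/
noncomputable def gInitF : List Bool → List Bool :=
  fanoutFn (fstF ∘ fstF) (fanoutFn (sndF ∘ fstF) (fanoutFn (fstF ∘ sndF) (fanoutFn (sndF ∘ sndF)
    (fanoutFn (fun _ => []) (fun _ => [])))))
/-- **`glFn ⟨⟨1ᵏ, 1ⁿ⟩, ⟨x, σ⟩⟩ = GL_k(x, σ)`**: `k` rounds from the initial state, then the
accumulator. [Goldreich 2001, Thm 2.5.6; Y. Liu, R. Pass, FOCS 2020, Appendix] [folklore] -/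
noncomputable def glFn : List Bool → List Bool :=
  sndPow 4 ∘ (fun S => gRoundF^[(X : Polynomial ℕ).eval (boolUnpair S).1.length] S) ∘ gInitF

/-- The round's bit on every word. [folklore] -/
theorem gbitF_apply (S : List Bool) : gbitF S = [decide (Odd (((nthF 2 S).zipWith (· && ·) (blkF S)).count true))] := by
  simp only [gbitF, Function.comp_apply, fanoutFn_apply, andParityFn_boolPair]

/-- **One round on a state**: it appends `⟨x, σ_j⟩`. [folklore] -/
theorem gRoundF_gState (k n : ℕ) (x σ : List Bool) (j : ℕ) (acc : List Bool) :
    gRoundF (gState k n x σ j acc) = gState k n x σ (j + 1) (acc ++ [ipBit x ((σ.drop (j * n)).take n)]) := by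
  have hb := gbitF_apply (gState k n x σ j acc)
  have hblk : blkF (gState k n x σ j acc) = (σ.drop (j * n)).take n := by
    simp only [blkF, blkStartU, gState, Function.comp_apply, fanoutFn_apply, nthF_succ_boolPair, nthF_zero_boolPair,
      umulFn_boolPair, dropFn_boolPair, takeFn_boolPair, List.length_replicate, ones]
  rw [hblk] at hb
  simp only [gState, nthF_succ_boolPair, nthF_zero_boolPair] at hb
  simp only [gRoundF, fanoutFn_apply, Function.comp_apply, gState, fstF_boolPair, nthF_succ_boolPair, nthF_zero_boolPair,
    sndPow_succ_boolPair, sndPow_zero_boolPair, concatFn_boolPair, hb, ipBit_eq_decide_odd, true_cons_ones]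

/-- The rounds fill in the bits one by one. [folklore] -/
theorem iterate_gRoundF (k n : ℕ) (x σ : List Bool) : ∀ j : ℕ,
    gRoundF^[j] (gState k n x σ 0 []) = gState k n x σ j ((List.range j).map fun i => ipBit x ((σ.drop (i * n)).take n))
  | 0 => by simp [gState]
  | j + 1 => by
    rw [Function.iterate_succ_apply', iterate_gRoundF k n x σ j, gRoundF_gState, List.range_succ, List.map_append,
      List.map_singleton]

/-- **`glFn ⟨⟨1ᵏ, 1ⁿ⟩, ⟨x, σ⟩⟩ = glBits k n x σ`.** [folklore] -/
theorem glFn_boolPair (k n : ℕ) (x σ : List Bool) :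
    glFn (boolPair (boolPair (ones k) (ones n)) (boolPair x σ)) = glBits k n x σ := by
  have hinit : gInitF (boolPair (boolPair (ones k) (ones n)) (boolPair x σ)) = gState k n x σ 0 [] := by
    simp [gInitF, gState, fstF, sndF, ones]
  have h := iterate_gRoundF k n x σ k
  simp only [glFn, Function.comp_apply, hinit]
  rw [show (boolUnpair (gState k n x σ 0 [])).1.length = k by simp [gState, ones], eval_X, h, glBits]
  simp [gState, sndPow]

/-- `gRoundF ∈ FP`. [folklore] -/
theorem gRoundF_mem_FP : gRoundF ∈ FP :=
  fanoutFn_mem_FP fstF_mem_FP (fanoutFn_mem_FP (nthF_mem_FP 1) (fanoutFn_mem_FP (nthF_mem_FP 2) (fanoutFn_mem_FP (nthF_mem_FP 3)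
    (fanoutFn_mem_FP (comp_mem_FP (cons_mem_FP true) (nthF_mem_FP 4)) (comp_mem_FP concatFn_mem_FP
      (fanoutFn_mem_FP (sndPow_mem_FP 4) (comp_mem_FP andParityFn_mem_FP (fanoutFn_mem_FP (nthF_mem_FP 2)
        (comp_mem_FP takeFn_mem_FP (fanoutFn_mem_FP (nthF_mem_FP 1) (comp_mem_FP dropFn_mem_FP
          (fanoutFn_mem_FP (comp_mem_FP umulFn_mem_FP (fanoutFn_mem_FP (nthF_mem_FP 4) (nthF_mem_FP 1))) (nthF_mem_FP 3)))))))))))))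

/-- `gInitF ∈ FP`. [folklore] -/
theorem gInitF_mem_FP : gInitF ∈ FP :=
  fanoutFn_mem_FP (comp_mem_FP fstF_mem_FP fstF_mem_FP) (fanoutFn_mem_FP (comp_mem_FP sndF_mem_FP fstF_mem_FP)
    (fanoutFn_mem_FP (comp_mem_FP fstF_mem_FP sndF_mem_FP) (fanoutFn_mem_FP (comp_mem_FP sndF_mem_FP sndF_mem_FP)
      (fanoutFn_mem_FP (const_mem_FP _) (const_mem_FP _)))))

/-- The round's bit is one bit long on every word. [folklore] -/
theorem length_gbitF (S : List Bool) : (gbitF S).length = 1 := by rw [gbitF_apply]; rfl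

/-- **Additive growth of the round on every word** (`+13`, as `AffineProg.length_roundF_le`). [folklore] -/
theorem length_gRoundF_le (S : List Bool) : (gRoundF S).length ≤ S.length + 13 := by
  have h0 := length_fstF_sndF_le S
  have h1 := length_fstF_sndF_le (sndF S)
  have h2 := length_fstF_sndF_le (sndF (sndF S))
  have h3 := length_fstF_sndF_le (sndF (sndF (sndF S)))
  have h4 := length_fstF_sndF_le (sndF (sndF (sndF (sndF S))))
  have hb := length_gbitF S
  have e1 : nthF 1 S = fstF (sndF S) := rfl
  have e2 : nthF 2 S = fstF (sndF (sndF S)) := rfl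
  have e3 : nthF 3 S = fstF (sndF (sndF (sndF S))) := rfl
  have e4 : nthF 4 S = fstF (sndF (sndF (sndF (sndF S)))) := rfl
  have e5 : sndPow 4 S = sndF (sndF (sndF (sndF (sndF S)))) := rfl
  simp only [gRoundF, fanoutFn_apply, Function.comp_apply, length_boolPair, List.length_cons, concatFn_boolPair,
    List.length_append, hb, e1, e2, e3, e4, e5]
  omega

/-- **`glFn ∈ FP`**: the Goldreich–Levin bits are polynomial time. [Goldreich 2001, Thm 2.5.6;
Arora–Barak 2009, §1.3–1.4] [folklore] -/
theorem glFn_mem_FP : glFn ∈ FP :=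
  comp_mem_FP (sndPow_mem_FP 4) (comp_mem_FP (iterate_mem_FP gRoundF_mem_FP 13 length_gRoundF_le X) gInitF_mem_FP)

/-! ### `GL = L53Params.Hc` as a pipeline -/

variable (Q)

/-- `x = w ↾ N`, `N = nOf |w|`. [folklore] -/
noncomputable def xF : List Bool → List Bool := takeFn ∘ fanoutFn (nOfU Q) id
/-- `w ⇂ N`. [folklore] -/
noncomputable def restF : List Bool → List Bool := dropFn ∘ fanoutFn (nOfU Q) id
/-- `σ = (w ⇂ N) ⇂ m(N)`. [folklore] -/
noncomputable def sigF : List Bool → List Bool := dropFn ∘ fanoutFn (mU Q ∘ nOfU Q) (restF Q)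
/-- **`HcF = GL`**: `glFn ⟨⟨1^{k(N)}, 1^N⟩, ⟨x, σ⟩⟩`. [Y. Liu, R. Pass, FOCS 2020, Lemma 5.3] [folklore] -/
noncomputable def HcF : List Bool → List Bool :=
  glFn ∘ fanoutFn (fanoutFn (kkU Q ∘ nOfU Q) (nOfU Q)) (fanoutFn (xF Q) (sigF Q))

variable {Q}

/-- **`HcF = L53Params.Hc`.** [folklore] -/
theorem HcF_apply (w : List Bool) : HcF Q w = Q.Hc w := by
  simp only [HcF, xF, restF, sigF, Function.comp_apply, fanoutFn_apply, nOfU_apply, kkU_apply, mU_apply, id,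
    List.length_replicate, ones, takeFn_boolPair, dropFn_boolPair, L53Params.Hc]
  exact glFn_boolPair _ _ _ _

/-- `HcF ∈ FP`. [folklore] -/
theorem HcF_mem_FP : HcF Q ∈ FP :=
  comp_mem_FP glFn_mem_FP (fanoutFn_mem_FP (fanoutFn_mem_FP (comp_mem_FP kkU_mem_FP nOfU_mem_FP) nOfU_mem_FP)
    (fanoutFn_mem_FP (comp_mem_FP takeFn_mem_FP (fanoutFn_mem_FP nOfU_mem_FP OracleCompose.id_mem_FP))
      (comp_mem_FP dropFn_mem_FP (fanoutFn_mem_FP (comp_mem_FP mU_mem_FP nOfU_mem_FP)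
        (comp_mem_FP dropFn_mem_FP (fanoutFn_mem_FP nOfU_mem_FP OracleCompose.id_mem_FP))))))

/-! ### The family `⟨1ⁱ, w⟩ ↦ f'_i(w)` as a pipeline -/

/-- `L − (L − i) = min i L`. [folklore] -/
theorem sub_sub_eq_min (i L : ℕ) : L - (L - i) = min i L := by omega

variable (Q)

/-- `1^N`, `N = nOf |w|`, from `⟨1ⁱ, w⟩`. [folklore] -/
noncomputable def uN' : List Bool → List Bool := nOfU Q ∘ sndF
/-- `x = w ↾ N`. [folklore] -/
noncomputable def xF' : List Bool → List Bool := takeFn ∘ fanoutFn (uN' Q) sndF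
/-- `w ⇂ N`. [folklore] -/
noncomputable def rest' : List Bool → List Bool := dropFn ∘ fanoutFn (uN' Q) sndF
/-- `ρ = (w ⇂ N) ↾ m(N)`. [folklore] -/
noncomputable def rhoF : List Bool → List Bool := takeFn ∘ fanoutFn (mU Q ∘ uN' Q) (rest' Q)
/-- The pass-through part `(w ⇂ N) ⇂ m(N)`. [folklore] -/
noncomputable def sig' : List Bool → List Bool := dropFn ∘ fanoutFn (mU Q ∘ uN' Q) (rest' Q)
/-- `1^{L(N)}`. [folklore] -/
noncomputable def LN : List Bool → List Bool := LU Q ∘ uN' Q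
/-- `1^a`, `a = min i L(N)` (`aOf`), as `L − (L − i)` by two `drop`s. [folklore] -/
noncomputable def aU : List Bool → List Bool := dropFn ∘ fanoutFn (dropFn ∘ fanoutFn fstF (LN Q)) (LN Q)
/-- `1^b`, `b = L(N) − a` (`bOf`). [folklore] -/
noncomputable def bU : List Bool → List Bool := dropFn ∘ fanoutFn (aU Q) (LN Q)
/-- The first key `ρ ↾ R₁`. [folklore] -/
noncomputable def k1F : List Bool → List Bool := takeFn ∘ fanoutFn (R1U ∘ uN' Q) (rhoF Q)
/-- The second key `(ρ ⇂ R₁) ↾ R₂`. [folklore] -/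
noncomputable def k2F : List Bool → List Bool := takeFn ∘ fanoutFn (R2U Q ∘ uN' Q) (dropFn ∘ fanoutFn (R1U ∘ uN' Q) (rhoF Q))
/-- `1^{M(N)}`. [folklore] -/
noncomputable def MN : List Bool → List Bool := MU Q ∘ uN' Q
/-- `pad N (f x) = fitLen (f x ‖ 1) M(N)`. [folklore] -/
noncomputable def padF : List Bool → List Bool := CondGen.fitF (MN Q) (concatFn ∘ fanoutFn (Q.f ∘ xF' Q) (fun _ => [true]))
/-- `h¹_{R₁}(x) = hashStr N a (ρ ↾ R₁) x`. [folklore] -/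
noncomputable def h1F : List Bool → List Bool := AffineProg.hashFn ∘ fanoutFn (fanoutFn (uN' Q) (aU Q)) (fanoutFn (k1F Q) (xF' Q))
/-- `h²_{R₂}(pad (f x)) = hashStr M b ((ρ ⇂ R₁) ↾ R₂) (pad N (f x))`. [folklore] -/
noncomputable def h2F : List Bool → List Bool := AffineProg.hashFn ∘ fanoutFn (fanoutFn (MN Q) (bU Q)) (fanoutFn (k2F Q) (padF Q))
/-- **`FF ⟨1ⁱ, w⟩ = f'_i(w) = ρ ‖ h¹ ‖ h² ‖ σ`.** [Y. Liu, R. Pass, FOCS 2020, Lemma 5.3 / Appendix] [folklore] -/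
noncomputable def FF : List Bool → List Bool :=
  concatFn ∘ fanoutFn (concatFn ∘ fanoutFn (concatFn ∘ fanoutFn (rhoF Q) (h1F Q)) (h2F Q)) (sig' Q)

variable {Q}

/-- **`FF z = f'_{|z.1|}(z.2)`** (`L53Params.F`). [folklore] -/
theorem FF_apply (z : List Bool) : FF Q z = Q.F (boolUnpair z).1.length (boolUnpair z).2 := by
  have ha : (Q.L (Q.nOf (boolUnpair z).2.length) - (Q.L (Q.nOf (boolUnpair z).2.length) - (boolUnpair z).1.length)) =
      Q.aOf (boolUnpair z).1.length (Q.nOf (boolUnpair z).2.length) := sub_sub_eq_min _ _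
  simp only [FF, h1F, h2F, padF, MN, k1F, k2F, aU, bU, LN, sig', rhoF, rest', xF', uN', Function.comp_apply,
    fanoutFn_apply, nOfU_apply, mU_apply, LU_apply, MU_apply, R1U_apply, R2U_apply, List.length_replicate, takeFn_boolPair,
    dropFn_boolPair, concatFn_boolPair, Com.drop_ones, AffineProg.hashFn_boolPair, CondGen.fitF_apply, fstF, sndF, ha,
    L53Params.F, L53Params.gcore, L53Params.bOf, L53Params.pad, List.append_assoc]

/-- `FF ∈ FP` for `f ∈ FP`. [folklore] -/
theorem FF_mem_FP (hf : Q.f ∈ FP) : FF Q ∈ FP := by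
  have huN : uN' Q ∈ FP := comp_mem_FP nOfU_mem_FP sndF_mem_FP
  have hx : xF' Q ∈ FP := comp_mem_FP takeFn_mem_FP (fanoutFn_mem_FP huN sndF_mem_FP)
  have hrest : rest' Q ∈ FP := comp_mem_FP dropFn_mem_FP (fanoutFn_mem_FP huN sndF_mem_FP)
  have hmN : mU Q ∘ uN' Q ∈ FP := comp_mem_FP mU_mem_FP huN
  have hrho : rhoF Q ∈ FP := comp_mem_FP takeFn_mem_FP (fanoutFn_mem_FP hmN hrest)
  have hsig : sig' Q ∈ FP := comp_mem_FP dropFn_mem_FP (fanoutFn_mem_FP hmN hrest)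
  have hLN : LN Q ∈ FP := comp_mem_FP LU_mem_FP huN
  have ha : aU Q ∈ FP := comp_mem_FP dropFn_mem_FP (fanoutFn_mem_FP (comp_mem_FP dropFn_mem_FP (fanoutFn_mem_FP fstF_mem_FP hLN)) hLN)
  have hb : bU Q ∈ FP := comp_mem_FP dropFn_mem_FP (fanoutFn_mem_FP ha hLN)
  have hR1 : R1U ∘ uN' Q ∈ FP := comp_mem_FP R1U_mem_FP huN
  have hk1 : k1F Q ∈ FP := comp_mem_FP takeFn_mem_FP (fanoutFn_mem_FP hR1 hrho)
  have hk2 : k2F Q ∈ FP := comp_mem_FP takeFn_mem_FP (fanoutFn_mem_FP (comp_mem_FP R2U_mem_FP huN)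
    (comp_mem_FP dropFn_mem_FP (fanoutFn_mem_FP hR1 hrho)))
  have hMN : MN Q ∈ FP := comp_mem_FP MU_mem_FP huN
  have hpad : padF Q ∈ FP := CondGen.fitF_mem_FP hMN (comp_mem_FP concatFn_mem_FP (fanoutFn_mem_FP (comp_mem_FP hf hx) (const_mem_FP _)))
  have hh1 : h1F Q ∈ FP := comp_mem_FP AffineProg.hashFn_mem_FP (fanoutFn_mem_FP (fanoutFn_mem_FP huN ha) (fanoutFn_mem_FP hk1 hx))
  have hh2 : h2F Q ∈ FP := comp_mem_FP AffineProg.hashFn_mem_FP (fanoutFn_mem_FP (fanoutFn_mem_FP hMN hb) (fanoutFn_mem_FP hk2 hpad))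
  exact comp_mem_FP concatFn_mem_FP (fanoutFn_mem_FP (comp_mem_FP concatFn_mem_FP (fanoutFn_mem_FP
    (comp_mem_FP concatFn_mem_FP (fanoutFn_mem_FP hrho hh1)) hh2)) hsig)

end L53Prog

/-- **The hard-core function `GL` of Lemma 5.3's construction is polynomial time.** [Y. Liu,
R. Pass, FOCS 2020, Lemma 5.3 ("efficiently computable `GL`")] [cite: LiuPassFOCS2020, Lemma 5.3 (proof, Appendix)] -/
theorem L53Params.Hc_mem_FP (Q : L53Params) : Q.Hc ∈ FP := by
  have h : Q.Hc = L53Prog.HcF Q := funext fun w => (L53Prog.HcF_apply w).symm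
  rw [h]
  exact L53Prog.HcF_mem_FP

/-- **The family `⟨1ⁱ, w⟩ ↦ f'_i(w)` of Lemma 5.3's construction is polynomial time** for `f ∈ FP`
(the first efficiency clause of `liuPass_lemma53`). [Y. Liu, R. Pass, FOCS 2020, Lemma 5.3
("efficiently computable family `{f'_i}`")] [cite: LiuPassFOCS2020, Lemma 5.3 (proof, Appendix)] -/
theorem L53Params.F_mem_FP (Q : L53Params) (hf : Q.f ∈ FP) :
    (fun z => Q.F (boolUnpair z).1.length (boolUnpair z).2) ∈ FP := by
  have h : (fun z => Q.F (boolUnpair z).1.length (boolUnpair z).2) = L53Prog.FF Q := funext fun z => (L53Prog.FF_apply z).symm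
  rw [h]
  exact L53Prog.FF_mem_FP hf

end Literature.Computability.Cryptography
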